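import Summits.PneNP.PneNP.Theorems.ExpanderLinearGeneratorsResolutionNFreeMaster
import HarnessLib

/-!
# The n-free resolution-size rung for expanding linear systems, VI: twin-closed systems

Support file for crux `stmt-PneNP-11442` (`ExpansionForcesDepthFregeSize`). The n-free size law of
file IV is polynomial in the expansion scale `r`; the restriction method cannot do better in
general, because a random restriction overloads some row once the rows outnumber `r^{Θ(ℓ)}`. This
file shows that row-abundance ALONE is not the obstruction: for systems with a TWIN STRUCTURE — a
fixed-point-free involution `τ` of the variables mapping every row support to itself, as for the
XOR-substituted systems `F[⊕₂]` (the 2-bit sum encoding of `F`) — the loads of the restriction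
"assign one twin of each pair" are deterministic (at most `|supp| / 2` on every row), no overload
event exists, and the master inequality becomes `1 ≤ |π| (3/4)^{W/2+1}`. Hence
(`resolution_size_twin`) an n-free, m-free EXPONENTIAL law at the resolution rung:

  every resolution refutation of `sumEncoding 1 E`, `E` `ℓ`-sparse and twin-closed with
  `(r, 3ℓ/4)`-boundary-expanding supports, `r ≥ 2`, has length `≥ (4/3)^{ℓ r / 16}`.

This is Ben-Sasson's XOR-substitution lifting of width to size, n-free because the pairing makes
the preservation of expansion deterministic.

References: E. Ben-Sasson, *Size space tradeoffs for resolution*, SIAM J. Comput. 38 (2009), §4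
(substitution formulas); E. Ben-Sasson, A. Wigderson, J. ACM 48 (2001), Thm. 6.5; J. Krajíček,
*Proof complexity* (CUP 2019), §13.4.
-/

namespace Summit.PneNP.PneNP.Theorems.ResNFree

set_option linter.dupNamespace false -- `Summit.PneNP.PneNP.…`: summit = sub-problem (D-0017)

open Finset Literature.Computability.Complexity Literature.Computability.MetaComplexity
open Summit.PneNP.PneNP.Theorems.ResKRestriction

variable {m n : ℕ}

/-- **Twin pairs halve the load.** If `τ` is an injective self-map of `Fin n` mapping the set `S`
to itself and `fixed j` excludes `fixed (τ j)`, then at most `|S|/2` points of `S` are fixed.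
[folklore] -/
theorem two_mul_card_filter_le {S : Finset (Fin n)} (τ : Fin n → Fin n)
    (hτ : Function.Injective τ) (hS : ∀ j, τ j ∈ S ↔ j ∈ S) (fixed : Fin n → Prop)
    [DecidablePred fixed] (hfix : ∀ j, fixed j → ¬ fixed (τ j)) :
    2 * (S.filter fixed).card ≤ S.card := by
  classical
  have hinj : Set.InjOn τ ↑(S.filter fixed) := fun a _ b _ h => hτ h
  have hmaps : ∀ j ∈ S.filter fixed, τ j ∈ S.filter fun j => ¬ fixed j := by
    intro j hj
    rw [Finset.mem_filter] at hj ⊢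
    exact ⟨(hS j).2 hj.1, hfix j hj.2⟩
  have h1 : (S.filter fixed).card ≤ (S.filter fun j => ¬ fixed j).card :=
    Finset.card_le_card_of_injOn τ hmaps hinj
  have h2 := Finset.card_filter_add_card_filter_not (s := S) fixed
  omega

/-- **The n-free exponential resolution-size law for twin-closed expanders.** Let `E` be
`ℓ`-sparse (`ℓ ≥ 1`) with `(r, 3ℓ/4)`-boundary-expanding supports, `r ≥ 2`, and TWIN-CLOSED: some
fixed-point-free involution `τ` of the variables maps every row support to itself. Then every
resolution refutation of `sumEncoding 1 E` has at least `(4/3)^{ℓ r / 16}` lines, for any `n`, `m`.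
(Restrict one twin of each pair, chosen together with its value uniformly at random: every row
keeps at least half of its variables, so file I applies with load `ℓ/2`; a line left unsatisfied
with `> W` unassigned literals meets `> W/2` pairs and survives each with probability `≤ 3/4`.)
[Ben-Sasson 2009, §4; Ben-Sasson–Wigderson 2001, Thm. 6.5] [folklore] -/
theorem resolution_size_twin (ℓ : ℕ) (hℓ : 1 ≤ ℓ) {r : ℝ} (hr : 2 ≤ r)
    (E : Fin m → LinEqMod 2 n) (hsparse : ∀ i, (E i).supp.card ≤ ℓ)
    (hexp : IsBoundaryExpander (fun i => (E i).supp.map Fin.valEmbedding) r (3 / 4 * ℓ))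
    (τ : Fin n → Fin n) (hτ : Function.Involutive τ) (hτne : ∀ j, τ j ≠ j)
    (hsupp : ∀ i j, τ j ∈ (E i).supp ↔ j ∈ (E i).supp)
    {π : List (ResLine ℕ)} (hπ : IsResRefutation (sumEncoding 1 E) π) :
    (4 / 3 : ℝ) ^ ((ℓ : ℝ) * r / 16) ≤ (π.length : ℝ) := by
  classical
  -- constants: `c = 3ℓ/4`, load `L = ℓ/2`, `c - L ≥ ℓ/4`
  set c : ℝ := 3 / 4 * ℓ with hc
  have hℓ' : (1 : ℝ) ≤ ℓ := by exact_mod_cast hℓ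
  set L : ℕ := ℓ / 2 with hL
  have hLle : (L : ℝ) ≤ (ℓ : ℝ) / 2 := by
    have h := Nat.div_mul_le_self ℓ 2
    have : ((ℓ / 2 * 2 : ℕ) : ℝ) ≤ ℓ := by exact_mod_cast h
    push_cast at this
    rw [hL]; linarith
  have hLc : (L : ℝ) < c := by rw [hc]; linarith
  have hr0 : 0 < r := by linarith
  -- the width threshold
  set x : ℝ := (c - L) * r / 2 with hx
  have hxge : (ℓ : ℝ) * r / 8 ≤ x := by
    rw [hx, hc]
    have : (ℓ : ℝ) / 4 * r ≤ (3 / 4 * ℓ - L) * r := mul_le_mul_of_nonneg_right (by linarith) hr0.le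
    linarith
  have hxpos : 0 < x := by
    have : 0 < (ℓ : ℝ) * r / 8 := by positivity
    linarith
  set W : ℕ := ⌈x⌉₊ - 1 with hWdef
  have hW1 : 1 ≤ ⌈x⌉₊ := Nat.one_le_iff_ne_zero.2 (Nat.ceil_pos.2 hxpos).ne'
  have hWreal : (W : ℝ) = ⌈x⌉₊ - 1 := by
    have : ((W + 1 : ℕ) : ℝ) = ⌈x⌉₊ := by rw [hWdef]; exact_mod_cast Nat.sub_add_cancel hW1
    push_cast at this
    linarith
  have hWx : (W : ℝ) < (c - L) * r / 2 := by
    have h1 : (⌈x⌉₊ : ℝ) < x + 1 := Nat.ceil_lt_add_one hxpos.le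
    rw [← hx]; linarith
  have hWge : x - 1 ≤ W := by
    have h1 : x ≤ (⌈x⌉₊ : ℝ) := Nat.le_ceil x
    linarith
  have hq : (ℓ : ℝ) * r / 16 ≤ ((W / 2 + 1 : ℕ) : ℝ) := by
    have hdm := Nat.div_add_mod W 2
    have hmod : W % 2 ≤ 1 := Nat.lt_succ_iff.1 (Nat.mod_lt _ (by norm_num))
    have h1 : ((2 * (W / 2) + W % 2 : ℕ) : ℝ) = W := by exact_mod_cast hdm
    have h2 : ((W % 2 : ℕ) : ℝ) ≤ 1 := by exact_mod_cast hmod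
    push_cast at h1 ⊢
    linarith
  -- pair representatives
  set rep : Fin n → Fin n := fun j => if j < τ j then j else τ j with hrep
  have hrepτ : ∀ j, rep (τ j) = rep j := by
    intro j
    have hjj : τ (τ j) = j := hτ j
    rcases lt_trichotomy j (τ j) with h | h | h
    · simp only [hrep, hjj, if_pos h, if_neg (not_lt.2 h.le)]
    · exact absurd h.symm (hτne j)
    · simp only [hrep, hjj, if_neg (not_lt.2 h.le), if_pos h]
  have hrep_or : ∀ j, rep j = j ∨ rep j = τ j := by
    intro j
    by_cases h : j < τ j
    · left; simp only [hrep, if_pos h]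
    · right; simp only [hrep, if_neg h]
  -- the fixed twin of a pair, the restriction and the assigned set of a sample
  set fixedVar : (Fin n → Bool × Bool) → Fin n → Fin n := fun ω p =>
    if (ω p).1 = true then p else τ p with hfixedVar
  set ρ : (Fin n → Bool × Bool) → ℕ → Option Bool := fun ω v =>
    if h : v < n then
      (if (⟨v, h⟩ : Fin n) = fixedVar ω (rep ⟨v, h⟩) then some (ω (rep ⟨v, h⟩)).2 else none)
    else some false with hρ
  set Aset : (Fin n → Bool × Bool) → Finset ℕ := fun ω =>
    (univ.filter fun j : Fin n => j = fixedVar ω (rep j)).map Fin.valEmbedding with hAset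
  have hfixed_or : ∀ ω j, fixedVar ω (rep j) = j ∨ fixedVar ω (rep j) = τ j := by
    intro ω j
    by_cases hω1 : (ω (rep j)).1 = true
    · simp only [hfixedVar, if_pos hω1]
      rcases hrep_or j with h2 | h2
      · left; exact h2
      · right; exact h2
    · simp only [hfixedVar, if_neg hω1]
      rcases hrep_or j with h2 | h2
      · right; rw [h2]
      · left; rw [h2, hτ j]
  -- of the two twins of a pair, at most one is fixed
  have hfix_twin : ∀ ω j, j = fixedVar ω (rep j) → ¬ τ j = fixedVar ω (rep (τ j)) := by
    intro ω j hj hτj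
    rw [hrepτ] at hτj
    exact hτne j (hτj.trans hj.symm)
  -- loads are at most `ℓ/2` on every row
  have hload : ∀ ω, ∀ k ∈ (univ : Finset (Fin m)), ((rowVars E k) ∩ Aset ω).card ≤ L := by
    intro ω k _
    have h1 : ((rowVars E k) ∩ Aset ω).card
        ≤ ((E k).supp.filter fun j => j = fixedVar ω (rep j)).card := by
      rw [← Finset.card_map Fin.valEmbedding]
      refine Finset.card_le_card fun v hv => ?_
      rw [Finset.mem_inter] at hv
      obtain ⟨hv1, hv2⟩ := hv
      obtain ⟨j, hj, rfl⟩ := mem_rowVars.1 hv1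
      obtain ⟨j', hj', hjj'⟩ := Finset.mem_map.1 hv2
      have : j' = j := Fin.ext (by simpa using hjj')
      subst this
      exact Finset.mem_map.2 ⟨j', Finset.mem_filter.2 ⟨hj, (Finset.mem_filter.1 hj').2⟩, rfl⟩
    have h2 := two_mul_card_filter_le τ hτ.injective (hsupp k) (fun j => j = fixedVar ω (rep j))
      (fun j hj => hfix_twin ω j hj)
    have h3 := hsparse k
    rw [hL]
    omega
  -- every initial line downloads a clause of some row
  have hU : ∀ l ∈ π, l.rule = ResRule.initial →
      ∃ k ∈ (univ : Finset (Fin m)), ∃ cl ∈ equationCNF 1 (E k), cl.toFinset = l.clause := by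
    intro l hl hrule
    obtain ⟨k, cl, hcl, hclC⟩ := exists_row_of_initial E hπ hl hrule
    exact ⟨k, Finset.mem_univ _, cl, hcl, hclC⟩
  -- every sample leaves an unsatisfied wide line
  have hbad : ∀ ω : Fin n → Bool × Bool,
      ∃ l ∈ π, ¬ SatisfiedBy (ρ ω) l.clause ∧ W < (restrictClause (ρ ω) l.clause).card := by
    intro ω
    have hρA : ∀ v, v < n → v ∉ Aset ω → ρ ω v = none := by
      intro v hv hvA
      simp only [hρ, hv, ↓reduceDIte]
      split_ifs with h0
      · refine absurd ?_ hvA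
        simp only [hAset]
        exact Finset.mem_map.2 ⟨⟨v, hv⟩, Finset.mem_filter.2 ⟨Finset.mem_univ _, h0⟩, rfl⟩
      · rfl
    exact exists_unsatisfied_wide_line E hexp hr hLc hWx hπ hU (hload ω) (ρ ω) hρA
  -- the bad set of a line is small: avoid one of four values on each pair met by the line
  have hcount : ∀ C : Finset (Literal ℕ),
      (((univ : Finset (Fin n → Bool × Bool)).filter fun ω =>
        ¬ SatisfiedBy (ρ ω) C ∧ W < (restrictClause (ρ ω) C).card).card : ℝ)
        ≤ (3 / 4 : ℝ) ^ (W / 2 + 1) * (4 : ℝ) ^ n := by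
    intro C
    set s := (univ : Finset (Fin n → Bool × Bool)).filter fun ω =>
      ¬ SatisfiedBy (ρ ω) C ∧ W < (restrictClause (ρ ω) C).card with hs
    rcases s.eq_empty_or_nonempty with hs0 | ⟨ω₀, hω₀⟩
    · rw [hs0, Finset.card_empty, Nat.cast_zero]; positivity
    -- the pairs met by `C`, through their representatives
    set P : Finset (Fin n) := univ.filter fun p =>
      ∃ l ∈ C, ∃ h : l.1 < n, rep ⟨l.1, h⟩ = p with hP
    -- (i) a bad sample has `W < 2 |P|`: unassigned literals live on the non-fixed twins
    have hwide : ∀ ω ∈ s, W < 2 * P.card := by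
      intro ω hω
      obtain ⟨-, hWlt⟩ := (Finset.mem_filter.1 hω).2
      refine lt_of_lt_of_le hWlt ?_
      set liveVar : Fin n → Fin n := fun p => if (ω p).1 = true then τ p else p with hliveVar
      have hlive : ∀ j : Fin n, j ≠ fixedVar ω (rep j) → j = liveVar (rep j) := by
        intro j hj
        have h1 : fixedVar ω (rep j) = τ j := (hfixed_or ω j).resolve_left (fun h => hj h.symm)
        by_cases hω1 : (ω (rep j)).1 = true
        · simp only [hfixedVar, if_pos hω1] at h1
          show j = (if (ω (rep j)).1 = true then τ (rep j) else rep j)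
          rw [if_pos hω1, h1, hτ j]
        · simp only [hfixedVar, if_neg hω1] at h1
          show j = (if (ω (rep j)).1 = true then τ (rep j) else rep j)
          rw [if_neg hω1]
          exact (hτ.injective h1).symm
      have hsub : restrictClause (ρ ω) C
          ⊆ (P ×ˢ (univ : Finset Bool)).image fun q => (((liveVar q.1 : Fin n) : ℕ), q.2) := by
        intro l hl
        obtain ⟨hlC, hnone⟩ := mem_restrictClause.1 hl
        have hln : l.1 < n := by
          by_contra h
          simp [hρ, h] at hnone
        have hnfix : (⟨l.1, hln⟩ : Fin n) ≠ fixedVar ω (rep ⟨l.1, hln⟩) := by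
          intro hfix
          simp only [hρ, hln, ↓reduceDIte] at hnone
          rw [if_pos hfix] at hnone
          exact absurd hnone (by simp)
        have hj := hlive ⟨l.1, hln⟩ hnfix
        refine Finset.mem_image.2 ⟨(rep ⟨l.1, hln⟩, l.2), Finset.mem_product.2
          ⟨Finset.mem_filter.2 ⟨Finset.mem_univ _, l, hlC, hln, rfl⟩, Finset.mem_univ _⟩, ?_⟩
        have hval : ((liveVar (rep ⟨l.1, hln⟩) : Fin n) : ℕ) = l.1 := by
          rw [← hj]
        ext
        · exact hval
        · rfl
      calc (restrictClause (ρ ω) C).card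
          ≤ ((P ×ˢ (univ : Finset Bool)).image fun q => (((liveVar q.1 : Fin n) : ℕ), q.2)).card :=
            Finset.card_le_card hsub
        _ ≤ (P ×ˢ (univ : Finset Bool)).card := Finset.card_image_le
        _ = 2 * P.card := by rw [Finset.card_product, Finset.card_univ, Fintype.card_bool, mul_comm]
    have hPq : W / 2 + 1 ≤ P.card := by
      have := hwide ω₀ hω₀
      omega
    -- (ii) the value avoided on each pair met by `C`
    have hPlit : ∀ p ∈ P, ∃ l ∈ C, ∃ h : l.1 < n, rep ⟨l.1, h⟩ = p := fun p hp =>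
      (Finset.mem_filter.1 hp).2
    choose! lit hlitC hlitn hlitrep using hPlit
    set g : Fin n → Bool × Bool := fun p => (decide ((lit p).1 = (p : ℕ)), (lit p).2) with hg
    have havoid : ∀ ω ∈ s, ∀ p ∈ P, ω p ≠ g p := by
      intro ω hω p hp hωp
      obtain ⟨hns, -⟩ := (Finset.mem_filter.1 hω).2
      have hln := hlitn p hp
      have hrepp : rep ⟨(lit p).1, hln⟩ = p := hlitrep p hp
      refine hns ⟨lit p, hlitC p hp, ?_⟩
      -- `ρ ω (lit p).1 = some (lit p).2`
      have hfix : (⟨(lit p).1, hln⟩ : Fin n) = fixedVar ω (rep ⟨(lit p).1, hln⟩) := by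
        rw [hrepp]
        by_cases heq : (lit p).1 = (p : ℕ)
        · have hω1 : (ω p).1 = true := by rw [hωp, hg]; simp [heq]
          simp only [hfixedVar, if_pos hω1]
          exact Fin.ext heq
        · have hω1 : ¬ (ω p).1 = true := by rw [hωp, hg]; simp [heq]
          simp only [hfixedVar, if_neg hω1]
          rcases hrep_or ⟨(lit p).1, hln⟩ with h2 | h2
          · exact absurd (congrArg Fin.val (h2.symm.trans hrepp)) heq
          · rw [hrepp] at h2
            have h3 : τ p = ⟨(lit p).1, hln⟩ := by
              have := congrArg τ h2
              rwa [hτ ⟨(lit p).1, hln⟩] at this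
            exact h3.symm
      have hval : (ω (rep ⟨(lit p).1, hln⟩)).2 = (lit p).2 := by
        rw [hrepp, hωp, hg]
      simp only [hρ, hln, ↓reduceDIte]
      rw [if_pos hfix, hval]
    have hcard : s.card ≤ (Fintype.card (Bool × Bool) - 1) ^ P.card *
        Fintype.card (Bool × Bool) ^ (Fintype.card (Fin n) - P.card) :=
      card_le_of_forall_ne P g s havoid
    rw [Fintype.card_prod, Fintype.card_bool, Fintype.card_fin] at hcard
    norm_num at hcard
    -- `3^|P| 4^{n-|P|} ≤ (3/4)^{W/2+1} 4^n`
    have hPn : P.card ≤ n := (Finset.card_le_univ _).trans (by rw [Fintype.card_fin])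
    have h1 : (s.card : ℝ) ≤ (3 : ℝ) ^ P.card * (4 : ℝ) ^ (n - P.card) := by exact_mod_cast hcard
    have h2 : (3 : ℝ) ^ P.card * (4 : ℝ) ^ (n - P.card) = (3 / 4 : ℝ) ^ P.card * (4 : ℝ) ^ n := by
      rw [div_pow, div_mul_eq_mul_div, eq_div_iff (by positivity), mul_assoc, ← pow_add,
        Nat.sub_add_cancel hPn]
    have h3 : (3 / 4 : ℝ) ^ P.card ≤ (3 / 4 : ℝ) ^ (W / 2 + 1) :=
      pow_le_pow_of_le_one (by norm_num) (by norm_num) hPq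
    calc (s.card : ℝ) ≤ (3 : ℝ) ^ P.card * (4 : ℝ) ^ (n - P.card) := h1
      _ = (3 / 4 : ℝ) ^ P.card * (4 : ℝ) ^ n := h2
      _ ≤ (3 / 4 : ℝ) ^ (W / 2 + 1) * (4 : ℝ) ^ n := mul_le_mul_of_nonneg_right h3 (by positivity)
  -- union bound over the lines
  set B : ResLine ℕ → Finset (Fin n → Bool × Bool) := fun l =>
    univ.filter fun ω => ¬ SatisfiedBy (ρ ω) l.clause ∧ W < (restrictClause (ρ ω) l.clause).card
    with hB
  have hcover : (univ : Finset (Fin n → Bool × Bool)) ⊆ π.toFinset.biUnion B := by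
    intro ω _
    obtain ⟨l, hl, hlω⟩ := hbad ω
    refine Finset.mem_biUnion.2 ⟨l, List.mem_toFinset.2 hl, ?_⟩
    simp only [hB, Finset.mem_filter, Finset.mem_univ, true_and]
    exact hlω
  have htot : (4 : ℝ) ^ n ≤ π.length * ((3 / 4 : ℝ) ^ (W / 2 + 1) * (4 : ℝ) ^ n) := by
    have h1 : 4 ^ n ≤ ∑ l ∈ π.toFinset, (B l).card :=
      calc 4 ^ n = (univ : Finset (Fin n → Bool × Bool)).card := by
            rw [Finset.card_univ, Fintype.card_fun, Fintype.card_prod, Fintype.card_bool,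
              Fintype.card_fin]
        _ ≤ (π.toFinset.biUnion B).card := Finset.card_le_card hcover
        _ ≤ ∑ l ∈ π.toFinset, (B l).card := Finset.card_biUnion_le
    have h1' : (4 : ℝ) ^ n ≤ ∑ l ∈ π.toFinset, ((B l).card : ℝ) := by exact_mod_cast h1
    have h2 : ∑ l ∈ π.toFinset, ((B l).card : ℝ)
        ≤ π.toFinset.card * ((3 / 4 : ℝ) ^ (W / 2 + 1) * (4 : ℝ) ^ n) := by
      calc ∑ l ∈ π.toFinset, ((B l).card : ℝ)
          ≤ ∑ l ∈ π.toFinset, (3 / 4 : ℝ) ^ (W / 2 + 1) * (4 : ℝ) ^ n :=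
            Finset.sum_le_sum fun l _ => hcount l.clause
        _ = π.toFinset.card * ((3 / 4 : ℝ) ^ (W / 2 + 1) * (4 : ℝ) ^ n) := by
            rw [Finset.sum_const, nsmul_eq_mul]
    have hπ' : (π.toFinset.card : ℝ) ≤ π.length := by exact_mod_cast List.toFinset_card_le π
    exact h1'.trans (h2.trans (mul_le_mul_of_nonneg_right hπ' (by positivity)))
  -- conclusion: `(4/3)^{ℓ r/16} ≤ (4/3)^{W/2+1} ≤ |π|`
  have h4n : (0 : ℝ) < (4 : ℝ) ^ n := by positivity
  have hone : (1 : ℝ) ≤ π.length * (3 / 4 : ℝ) ^ (W / 2 + 1) := by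
    by_contra hlt
    push Not at hlt
    have := mul_lt_mul_of_pos_right hlt h4n
    linarith
  have hpow : (4 / 3 : ℝ) ^ (W / 2 + 1) ≤ (π.length : ℝ) := by
    have h34 : (3 / 4 : ℝ) ^ (W / 2 + 1) * (4 / 3 : ℝ) ^ (W / 2 + 1) = 1 := by
      rw [← mul_pow]; norm_num
    calc (4 / 3 : ℝ) ^ (W / 2 + 1) = 1 * (4 / 3 : ℝ) ^ (W / 2 + 1) := (one_mul _).symm
      _ ≤ (π.length * (3 / 4 : ℝ) ^ (W / 2 + 1)) * (4 / 3 : ℝ) ^ (W / 2 + 1) :=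
          mul_le_mul_of_nonneg_right hone (by positivity)
      _ = π.length := by rw [mul_assoc, h34, mul_one]
  calc (4 / 3 : ℝ) ^ ((ℓ : ℝ) * r / 16) ≤ (4 / 3 : ℝ) ^ (((W / 2 + 1 : ℕ) : ℝ)) :=
        Real.rpow_le_rpow_of_exponent_le (by norm_num) hq
    _ = (4 / 3 : ℝ) ^ (W / 2 + 1) := Real.rpow_natCast _ _
    _ ≤ π.length := hpow

end Summit.PneNP.PneNP.Theorems.ResNFree
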